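import Literature.NumberTheory.Sieve.HeathBrownCubicSieveDecomposition
import Mathlib.Analysis.SpecialFunctions.Pow.Asymptotics
import HarnessLib

/-!
# Heath-Brown's (2.4) from Lemma 3.4, Lemmas 3.5–3.6 and the Type II block ((3.15), p. 21)

Pure-proof companion of `HeathBrownCubicSieveDecomposition` (sixth layer of the decomposition of
**parity.S18** along Heath-Brown, Acta Math. 186 (2001)). The previous layers prove Lemma 3.4
(`HeathBrown2001_lemma_3_4`) and vendor Lemma 3.5, Lemma 3.6 and the Type II block of (3.15) as
named facts. Here the bookkeeping of (3.15) and p. 21 is carried out: with `η = (log X)^{−c}`,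
`τ = (log log X)^{−1/6}` (`ϖ = 1/6`), `κ = σ₀η(3X)^{-1}`, the hypotheses of Lemma 3.4 hold for all
large `X` (`eventually_params`), its first term is `≤ 3σ₀ηX^{1/2} ≤ τη²X²/log X`, and the three
facts bound the rest by `(C₅ + 4C₆ + C_II)τη²X²/log X`; as
`τη²X²/log X = η²X²(log X)^{-1}(log log X)^{-1/6}`, this is exactly (2.4),
`HeathBrown2001_sieveComparison` — **PROVED from the three facts**
(`HeathBrown2001_sieveComparison_of`). Consequently
(`Literature.NumberTheory.Sieve.setOf_prime_cube_add_two_mul_cube_infinite_of_sieveLemmas`) parity.S18 rests on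
exactly four named facts: Landau's prime ideal theorem, Lemma 3.5 (Fundamental Lemma terms),
Lemma 3.6 (upper-bound sieve terms) and the Type II block (Lemmas 3.7–3.10 with the choices of
p. 21) — everything else in the chain (the top reduction, (2.2) ⇐ (2.3) + (2.4) + σ₀, σ₀'s
convergence, (2.3) ⇐ PIT, `𝓞_K = ℤ[2^{1/3}]`, Lemma 3.1, the norm form, `π(𝒜) = S_K(𝒜^(K), 2X^{3/2})`,
Buchstab's identity, (3.1)–(3.2), Lemma 3.4) is proved.

## References

* D. R. Heath-Brown, *Primes represented by `x³ + 2y³`*, Acta Math. 186 (2001), 1–84: (3.15) and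
  the parameter choices on p. 21. [cite: HeathBrownActa2001, §3 (3.15) and p. 21]

## Mathlib / tree search

Mathlib asymptotics used: `isLittleO_log_rpow_atTop`, `isLittleO_log_rpow_rpow_atTop`,
`tendsto_rpow_neg_atTop`, `Real.tendsto_log_atTop`, `Asymptotics.isBigO_iff`. Tree:
`HeathBrownCubicSieveDecomposition` (Lemma 3.4, the facts, `hbTau`, `chainBound`),
`HeathBrownCubicPrimesOutline` (`HeathBrown2001_sieveComparison`, `kappa`),
`HeathBrownCubicPrimes` (`singularProductPartial_pos`),
`HeathBrownCubicPrimesOutlineProofs.setOf_prime_cube_add_two_mul_cube_infinite_of_primeIdealTheorem`.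
-/

noncomputable section

open Polynomial NumberField Finset Filter Topology Asymptotics

namespace Literature.NumberTheory.Sieve.CubicSieve

open CubicPrimes

/-! ### The parameters `η = (log X)^{−c}`, `τ = (log log X)^{−1/6}` for large `X` -/

/-- Eventually (in `X`): `X ≥ 2`, `0 < η ≤ 1/10`, `η` lies in the range (2.1)
(`exp(−(log X)^{1/3}) ≤ η`), `0 < τ ≤ 1/4`, and the polynomially small term `A η X^{1/2}` is below
`τη²X²/log X`; here `η = (log X)^{−c}` (`c > 0`) and `τ = (log log X)^{−1/6}`. [folklore] -/
theorem eventually_params {c : ℝ} (hc : 0 < c) (A : ℝ) :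
    ∀ᶠ X : ℝ in atTop,
      2 ≤ X ∧ 0 < Real.log X ^ (-c) ∧ Real.log X ^ (-c) ≤ 1 / 10 ∧
        Real.exp (-Real.log X ^ (1 / 3 : ℝ)) ≤ Real.log X ^ (-c) ∧
        0 < hbTau (1 / 6) X ∧ hbTau (1 / 6) X ≤ 1 / 4 ∧
        A * Real.log X ^ (-c) * X ^ (1 / 2 : ℝ) ≤
          hbTau (1 / 6) X * (Real.log X ^ (-c)) ^ 2 * X ^ 2 / Real.log X := by
  -- (a) η → 0
  have hη : Tendsto (fun X : ℝ => Real.log X ^ (-c)) atTop (𝓝 0) :=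
    (tendsto_rpow_neg_atTop hc).comp Real.tendsto_log_atTop
  have hη10 : ∀ᶠ X : ℝ in atTop, Real.log X ^ (-c) ≤ 1 / 10 :=
    hη.eventually (ge_mem_nhds (by norm_num))
  -- (b) `c log L ≤ L^{1/3}` for `L = log X` large
  have hlog : ∀ᶠ L : ℝ in atTop, ‖Real.log L‖ ≤ (1 / c) * ‖L ^ (1 / 3 : ℝ)‖ :=
    (isLittleO_log_rpow_atTop (by norm_num : (0 : ℝ) < 1 / 3)).def (by positivity)
  -- (c) `(|A| + 1) (log X)^{c+2} ≤ X^{3/2}`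
  have hpow : ∀ᶠ X : ℝ in atTop, ‖Real.log X ^ (c + 2)‖ ≤ (1 / (|A| + 1)) * ‖X ^ (3 / 2 : ℝ)‖ :=
    (isLittleO_log_rpow_rpow_atTop (c + 2) (by norm_num : (0 : ℝ) < 3 / 2)).def (by positivity)
  -- (d) `log log X ≥ 4096`
  have hM : ∀ᶠ X : ℝ in atTop, (4096 : ℝ) ≤ Real.log (Real.log X) :=
    (Real.tendsto_log_atTop.comp Real.tendsto_log_atTop).eventually (eventually_ge_atTop _)
  filter_upwards [eventually_ge_atTop (2 : ℝ), hη10, Real.tendsto_log_atTop.eventually hlog, hpow,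
    hM, Real.tendsto_log_atTop.eventually (eventually_ge_atTop (1 : ℝ))] with X hX2 hη10X hlogX hpowX hMX hL1
  set L := Real.log X with hL
  set M := Real.log L with hMdef
  set η := L ^ (-c) with hηdef
  have hX0 : 0 < X := by linarith
  have hLpos : 0 < L := by linarith
  have hMpos : 0 < M := by linarith
  have hη0 : 0 < η := Real.rpow_pos_of_pos hLpos _
  have hηinv : η = (L ^ c)⁻¹ := Real.rpow_neg hLpos.le c
  have hLc : 0 < L ^ c := Real.rpow_pos_of_pos hLpos _
  -- (2.1)
  have h21 : Real.exp (-L ^ (1 / 3 : ℝ)) ≤ η := by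
    rw [hηinv, Real.exp_neg]
    refine inv_anti₀ hLc ?_
    have h1 : c * Real.log L ≤ L ^ (1 / 3 : ℝ) := by
      have hlogL : 0 ≤ Real.log L := Real.log_nonneg hL1
      have h13 : 0 < L ^ (1 / 3 : ℝ) := Real.rpow_pos_of_pos hLpos _
      rw [Real.norm_eq_abs, Real.norm_eq_abs, abs_of_nonneg hlogL, abs_of_pos h13] at hlogX
      calc c * Real.log L ≤ c * ((1 / c) * L ^ (1 / 3 : ℝ)) := by gcongr
        _ = L ^ (1 / 3 : ℝ) := by field_simp
    calc L ^ c = Real.exp (Real.log L * c) := Real.rpow_def_of_pos hLpos c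
      _ ≤ Real.exp (L ^ (1 / 3 : ℝ)) := Real.exp_le_exp.mpr (by linarith)
  -- τ
  have hτ : hbTau (1 / 6) X = (M ^ (1 / 6 : ℝ))⁻¹ := by
    rw [hbTau, ← hL, ← hMdef, show (-(1 / 6) : ℝ) = -(1 / 6 : ℝ) by norm_num, Real.rpow_neg hMpos.le]
  have hM6 : (4 : ℝ) ≤ M ^ (1 / 6 : ℝ) := by
    calc (4 : ℝ) = ((4 : ℝ) ^ (6 : ℕ)) ^ ((6 : ℕ) : ℝ)⁻¹ := by
          rw [Real.pow_rpow_inv_natCast (by norm_num) (by norm_num)]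
      _ = (4096 : ℝ) ^ (1 / 6 : ℝ) := by norm_num
      _ ≤ M ^ (1 / 6 : ℝ) := Real.rpow_le_rpow (by norm_num) hMX (by norm_num)
  have hM6pos : 0 < M ^ (1 / 6 : ℝ) := by linarith
  have hτ0 : 0 < hbTau (1 / 6) X := by rw [hτ]; positivity
  have hτ4 : hbTau (1 / 6) X ≤ 1 / 4 := by
    rw [hτ, inv_eq_one_div, div_le_div_iff₀ hM6pos (by norm_num)]
    linarith
  -- the first-term inequality
  have hfirst : A * η * X ^ (1 / 2 : ℝ) ≤ hbTau (1 / 6) X * η ^ 2 * X ^ 2 / L := by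
    -- `M^{1/6} ≤ L` and `(|A|+1) L^{c+2} ≤ X^{3/2}`
    have hML : M ^ (1 / 6 : ℝ) ≤ L := by
      have hML' : M ≤ L := by
        have := Real.log_le_sub_one_of_pos hLpos
        rw [← hMdef] at this; linarith
      have hM1 : 1 ≤ M := by linarith
      calc M ^ (1 / 6 : ℝ) ≤ M ^ (1 : ℝ) := Real.rpow_le_rpow_of_exponent_le hM1 (by norm_num)
        _ = M := Real.rpow_one M
        _ ≤ L := hML'
    have hX32 : 0 < X ^ (3 / 2 : ℝ) := Real.rpow_pos_of_pos hX0 _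
    have hX12 : 0 < X ^ (1 / 2 : ℝ) := Real.rpow_pos_of_pos hX0 _
    have hLc2 : 0 < L ^ (c + 2) := Real.rpow_pos_of_pos hLpos _
    have hpow' : (|A| + 1) * L ^ (c + 2) ≤ X ^ (3 / 2 : ℝ) := by
      rw [Real.norm_eq_abs, Real.norm_eq_abs, abs_of_pos hLc2, abs_of_pos hX32] at hpowX
      calc (|A| + 1) * L ^ (c + 2) ≤ (|A| + 1) * ((1 / (|A| + 1)) * X ^ (3 / 2 : ℝ)) := by gcongr
        _ = X ^ (3 / 2 : ℝ) := by field_simp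
    -- rewrite both sides with `η = (L^c)⁻¹`, `τ = (M^{1/6})⁻¹`, `X² = X^{1/2} X^{3/2}`,
    -- `L^{c+2} = L^c · L · L`
    have hX2eq : X ^ 2 = X ^ (1 / 2 : ℝ) * X ^ (3 / 2 : ℝ) := by
      rw [← Real.rpow_add hX0]; norm_num
    have hLc2eq : L ^ (c + 2) = L ^ c * L * L := by
      rw [Real.rpow_add hLpos, Real.rpow_two]; ring
    rw [hτ, hηinv, hX2eq]
    rw [hLc2eq] at hpow'
    -- goal: A (L^c)⁻¹ X^{1/2} ≤ (M^{1/6})⁻¹ (L^c)⁻¹² X^{1/2} X^{3/2} / L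
    rw [div_eq_mul_inv]
    have key : A * (M ^ (1 / 6 : ℝ) * L ^ c * L) ≤ X ^ (3 / 2 : ℝ) := by
      calc A * (M ^ (1 / 6 : ℝ) * L ^ c * L) ≤ |A| * (L * L ^ c * L) := by
            have h1 : A * (M ^ (1 / 6 : ℝ) * L ^ c * L) ≤ |A| * (M ^ (1 / 6 : ℝ) * L ^ c * L) :=
              mul_le_mul_of_nonneg_right (le_abs_self A) (by positivity)
            have h2 : |A| * (M ^ (1 / 6 : ℝ) * L ^ c * L) ≤ |A| * (L * L ^ c * L) := by
              gcongr
            linarith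
        _ ≤ (|A| + 1) * (L ^ c * L * L) := by nlinarith [abs_nonneg A]
        _ ≤ X ^ (3 / 2 : ℝ) := hpow'
    -- conclude by clearing denominators
    have hden : 0 < M ^ (1 / 6 : ℝ) * L ^ c * L := by positivity
    calc A * (L ^ c)⁻¹ * X ^ (1 / 2 : ℝ)
        = (A * (M ^ (1 / 6 : ℝ) * L ^ c * L)) * ((M ^ (1 / 6 : ℝ))⁻¹ * ((L ^ c)⁻¹ * (L ^ c)⁻¹) *
            X ^ (1 / 2 : ℝ) * L⁻¹) := by field_simp
      _ ≤ X ^ (3 / 2 : ℝ) * ((M ^ (1 / 6 : ℝ))⁻¹ * ((L ^ c)⁻¹ * (L ^ c)⁻¹) * X ^ (1 / 2 : ℝ) * L⁻¹) :=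
          mul_le_mul_of_nonneg_right key (by positivity)
      _ = (M ^ (1 / 6 : ℝ))⁻¹ * ((L ^ c)⁻¹) ^ 2 * (X ^ (1 / 2 : ℝ) * X ^ (3 / 2 : ℝ)) * L⁻¹ := by ring
  exact ⟨hX2, hη0, hη10X, h21, hτ0, hτ4, hfirst⟩


/-! ### (2.4) from Lemma 3.4 (proved), Lemmas 3.5, 3.6 and the Type II block -/

/-- `√(3X³(1+η)) ≤ 2X^{3/2}` for `X ≥ 0`, `η ≤ 1/3`. [folklore] -/
theorem sqrt_window_le {X η : ℝ} (hX : 0 ≤ X) (hη : η ≤ 1 / 3) :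
    Real.sqrt (3 * X ^ 3 * (1 + η)) ≤ 2 * X ^ (3 / 2 : ℝ) := by
  have hX3 : 0 ≤ X ^ 3 := pow_nonneg hX 3
  have h32 : X ^ (3 / 2 : ℝ) = Real.sqrt (X ^ 3) := by
    rw [Real.sqrt_eq_rpow, ← Real.rpow_natCast X 3, ← Real.rpow_mul hX]; norm_num
  rw [h32, show (2 : ℝ) = Real.sqrt 4 by rw [show (4 : ℝ) = 2 ^ 2 by norm_num, Real.sqrt_sq zero_le_two],
    ← Real.sqrt_mul (by norm_num)]
  exact Real.sqrt_le_sqrt (by nlinarith)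

/-- **(2.4) (`HeathBrown2001_sieveComparison`) from Lemma 3.4 (proved), Lemmas 3.5, 3.6 and the
Type II block** — the bookkeeping of (3.15) and p. 21: with `η = (log X)^{−c}` (`c` from the Type II
block), `τ = (log log X)^{−1/6}`, `κ = σ₀η(3X)^{-1}`, eventually every hypothesis of Lemma 3.4 holds,
its first term `3κ(√(3X³(1+η)) + 1) ≤ 3σ₀ηX^{1/2}` is below `τη²X²/log X`, and the remaining terms
are `≤ (C₅ + 4C₆ + C_II) τη²X²/log X`; since `τη²X²/log X = η²X²(log X)^{-1}(log log X)^{-1/6}` this is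
(2.4). [cite: HeathBrownActa2001, §3 (3.15) and p. 21] -/
theorem HeathBrown2001_sieveComparison_of (h35 : HeathBrown2001_lemma_3_5)
    (h36 : HeathBrown2001_lemma_3_6) (hII : HeathBrown2001_typeII_terms) :
    HeathBrown2001_sieveComparison := by
  intro σ₀ hσ
  have hσ0 : 0 ≤ σ₀ := ge_of_tendsto' hσ fun N => (singularProductPartial_pos N).le
  obtain ⟨c, hc, CII, XII, hIIb⟩ := hII σ₀ hσ
  obtain ⟨C5, X5, h5⟩ := h35 σ₀ hσ (1 / 6) (by norm_num) (by norm_num)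
  obtain ⟨C6, X6, h6⟩ := h36 σ₀ hσ (1 / 6) (by norm_num) (by norm_num)
  refine ⟨c, hc, ?_⟩
  rw [isBigO_iff]
  refine ⟨1 + |C5| + 4 * |C6| + |CII|, ?_⟩
  filter_upwards [eventually_params hc (3 * σ₀), eventually_ge_atTop X5, eventually_ge_atTop X6,
    eventually_ge_atTop XII] with X hP hX5 hX6 hXII
  obtain ⟨hX2, hη0, hη10, hηexp, hτ0, hτ4, hfirst⟩ := hP
  set L := Real.log X with hL
  set η := L ^ (-c) with hη
  set τ := hbTau (1 / 6) X with hτdef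
  set κ := kappa σ₀ X η with hκ
  have hX0 : 0 < X := by linarith
  have hX1 : 1 ≤ X := by linarith
  have hLpos : 0 < L := Real.log_pos (by linarith)
  have hκ0 : 0 ≤ κ := by rw [hκ, kappa]; positivity
  -- Lemma 3.4 and the three facts at this `X`
  have h34 := HeathBrown2001_lemma_3_4 (κ := κ) hX2 hη0.le hη10 hτ0 hτ4 hκ0
  have h5X := h5 X η hX5 hηexp (by linarith)
  obtain ⟨h63, h65, h66, h67⟩ := h6 X η hX6 hηexp (by linarith)
  have hIIX := hIIb X hXII
  set B := τ * η ^ 2 * X ^ 2 / L with hB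
  have hB0 : 0 ≤ B := by rw [hB]; positivity
  -- the first term
  have hfirst' : κ * (3 * (Real.sqrt (3 * X ^ 3 * (1 + η)) + 1)) ≤ B := by
    have hsq := sqrt_window_le hX0.le (by linarith : η ≤ 1 / 3)
    have hX12 : 0 < X ^ (1 / 2 : ℝ) := Real.rpow_pos_of_pos hX0 _
    have hX32 : X ^ (3 / 2 : ℝ) = X * X ^ (1 / 2 : ℝ) := by
      rw [← Real.rpow_one_add' hX0.le (by norm_num)]; norm_num
    have hX12ge : 1 ≤ X ^ (1 / 2 : ℝ) := Real.one_le_rpow hX1 (by norm_num)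
    have h1 : Real.sqrt (3 * X ^ 3 * (1 + η)) + 1 ≤ 3 * X * X ^ (1 / 2 : ℝ) := by
      rw [hX32] at hsq; nlinarith
    calc κ * (3 * (Real.sqrt (3 * X ^ 3 * (1 + η)) + 1))
        ≤ κ * (3 * (3 * X * X ^ (1 / 2 : ℝ))) := by gcongr
      _ = 3 * σ₀ * η * X ^ (1 / 2 : ℝ) := by rw [hκ, kappa]; field_simp
      _ ≤ B := hfirst
  -- bounds with nonnegative constants
  have h5' := h5X.trans (by
    show C5 * τ * η ^ 2 * X ^ 2 / L ≤ |C5| * B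
    rw [hB, show C5 * τ * η ^ 2 * X ^ 2 / L = C5 * (τ * η ^ 2 * X ^ 2 / L) by ring]
    exact mul_le_mul_of_nonneg_right (le_abs_self _) hB0)
  have hC6B : C6 * τ * η ^ 2 * X ^ 2 / L ≤ |C6| * B := by
    rw [hB, show C6 * τ * η ^ 2 * X ^ 2 / L = C6 * (τ * η ^ 2 * X ^ 2 / L) by ring]
    exact mul_le_mul_of_nonneg_right (le_abs_self _) hB0
  have hII' := hIIX.trans (by
    show CII * τ * η ^ 2 * X ^ 2 / L ≤ |CII| * B
    rw [hB, show CII * τ * η ^ 2 * X ^ 2 / L = CII * (τ * η ^ 2 * X ^ 2 / L) by ring]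
    exact mul_le_mul_of_nonneg_right (le_abs_self _) hB0)
  have h63' := h63.trans hC6B
  have h65' := h65.trans hC6B
  have h66' := h66.trans hC6B
  have h67' := h67.trans hC6B
  -- the norms
  have hg : η ^ 2 * X ^ 2 / L * Real.log L ^ (-(1 / 6 : ℝ)) = B := by
    rw [hB, hτdef, hbTau, ← hL]
    ring
  rw [Real.norm_eq_abs, Real.norm_eq_abs, hg, abs_of_nonneg hB0]
  refine h34.trans ?_
  linarith [hfirst', h5', h63', h65', h66', h67', hII']

/-- **The quantitative theorem (2.2) from the prime ideal theorem, Lemmas 3.5, 3.6 and the Type II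
block** (the singular product and everything between (2.2) and these inputs being proved).
[cite: HeathBrownActa2001, Theorem (p. 2)] -/
theorem HeathBrown2001_primePairCount_asymptotic_of_sieveLemmas
    (hPIT : Literature.NumberTheory.LFunctions.NumberField.primeIdealTheorem) (h35 : HeathBrown2001_lemma_3_5)
    (h36 : HeathBrown2001_lemma_3_6) (hII : HeathBrown2001_typeII_terms) :
    HeathBrown2001_primePairCount_asymptotic :=
  HeathBrown2001_primePairCount_asymptotic_of_primeIdealTheorem hPIT
    (HeathBrown2001_sieveComparison_of h35 h36 hII)

/-- **parity.S18 from the prime ideal theorem, Lemmas 3.5, 3.6 and the Type II block of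
Heath-Brown's paper**: the current frontier of the decomposition (Lemma 3.4 and everything above it
is proved). [cite: HeathBrownActa2001, Theorem (p. 2)] -/
theorem _root_.Literature.NumberTheory.Sieve.setOf_prime_cube_add_two_mul_cube_infinite_of_sieveLemmas
    (hPIT : Literature.NumberTheory.LFunctions.NumberField.primeIdealTheorem) (h35 : HeathBrown2001_lemma_3_5)
    (h36 : HeathBrown2001_lemma_3_6) (hII : HeathBrown2001_typeII_terms) :
    Literature.NumberTheory.Sieve.setOf_prime_cube_add_two_mul_cube_infinite :=
  Literature.NumberTheory.Sieve.setOf_prime_cube_add_two_mul_cube_infinite_of_primeIdealTheorem hPIT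
    (HeathBrown2001_sieveComparison_of h35 h36 hII)

end Literature.NumberTheory.Sieve.CubicSieve

end
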